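import Mathlib.Analysis.SpecialFunctions.Complex.Arg
import Mathlib.Analysis.SpecialFunctions.Complex.Log
import Literature.AlgebraicTopology.SingularHomology.CircleIntegralCocycle
import Literature.AlgebraicTopology.SingularHomology.SubsetCochainsEmbedding
import Literature.AlgebraicTopology.SingularHomology.HurewiczProofs
import Literature.AlgebraicTopology.SingularHomology.CechToSingular
import HarnessLib

/-!
# Winding cochains of nowhere-zero functions and the first Chern class of an exponential cocycle

Let `V = (V_i)` be a family of subsets of a space `X`, `G_ij : X → ℂ` continuous on `V_i ∩ V_j`
with `G_ij + G_jk − G_ik = 2πi n_ijk` (integers `n_ijk`) on `V_i ∩ V_j ∩ V_k` — so that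
`g_ij = exp G_ij` is a multiplicative `ℂˣ`-cocycle and `n` is "its first Chern class" as an
integer Čech `2`-cocycle (Griffiths–Harris p. 141: `c₁(L) = δ((1/2πi) log g)`; Bott–Tu (1982),
§6 and Prop. 11.? / p. 73 for the Euler class of a circle bundle) — and suppose the cocycle is a
COBOUNDARY OF CONTINUOUS UNITS: `h_j = exp(G_ij) h_i` on `V_i ∩ V_j` for functions `h_i`
continuous and nowhere zero on `V_i`. Then the Čech cocycle `n` dies in the singular cohomology of
the covered set: its image under the Čech-to-small map of
`Literature.AlgebraicTopology.SingularHomology.CechToSingular` vanishes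
(`cechToSmall_constCocycle_eq_zero_of_units`). This is the topological half of "`c₁` of a
trivial line bundle is zero", in a form that needs NO logarithms of the `h_i` (the sets `V_i` may
have any shape): the primitive is the explicit element of total degree `1` of the Čech–singular
double complex whose components are the integer WINDING `1`-cochains `w_i = h_i^* ϑ` of the `h_i`
(`ϑ` the integral winding cocycle of `ℝ/ℤ`, `CircleIntegralCocycle`) and the integer `0`-cochains
`e_ij = ⌊Im G_ij / 2π + θ_i⌋` (`θ_i ∈ [0,1)` the normalised angle of `h_i`); the identities
`δ_sing w_i = 0`, `w_j − w_i = δ_sing e_ij`, `e_ij + e_jk − e_ik = n_ijk` are the unique path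
lifting for `ℝ → ℝ/ℤ` (Hatcher Prop. 1.30 / Thm. 1.7).

* `turn : ℂ → ℝ/ℤ` — the normalised argument `arg z / 2π mod 1`, continuous off `0`, additive on
  products, `turn (exp ζ) = Im ζ / 2π`;
* `windingValue`, `windingValue_face` (cocycle identity), `windingValue_eq_floor` (as the end
  point of the lift of `t ↦ turn (h (τ t))`), `windingValue_mul_exp` (the coboundary identity);
* `constCechCocycle V n` — an integer-valued constant Čech `2`-cocycle of `0`-cocycles, and the
  theorem `cechToSmall_constCocycle_eq_zero_of_units`.

No named facts; everything is proved.

## References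

* A. Hatcher, *Algebraic Topology*, CUP 2002, Thm. 1.7, Prop. 1.30, §3.1 p. 198. [HatcherAT2002]
* P. Griffiths, J. Harris, *Principles of Algebraic Geometry*, Wiley 1978, pp. 139–141.
  [GriffithsHarris1978]
* R. Bott, L. W. Tu, *Differential Forms in Algebraic Topology*, Springer 1982, §8–§9,
  Prop. 9.5. [BottTu1982Forms]
-/

noncomputable section

set_option backward.isDefEq.respectTransparency false

open CategoryTheory Set Complex

namespace Literature.AlgebraicTopology.SingularHomology

open SingularSimplex HurewiczProof

/-! ### The normalised argument `turn : ℂ → ℝ/ℤ` -/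

section Turn

/-- **The normalised argument** `turn z = arg z / 2π ∈ ℝ/ℤ` (the angle `arg z ∈ ℝ/2πℤ` rescaled
to the circle of length `1`). [folklore] -/
def turn (z : ℂ) : UnitAddCircle :=
  AddCircle.equivAddCircle (2 * Real.pi) 1 (by positivity) one_ne_zero (Complex.arg z : Real.Angle)

/-- `turn` as the rescaling of the angle-valued argument. [folklore] -/
theorem turn_eq (z : ℂ) :
    turn z = AddCircle.equivAddCircle (2 * Real.pi) 1 (by positivity) one_ne_zero
      (Complex.arg z : Real.Angle) :=
  rfl

/-- `turn` of (the class of) a real angle `θ`: `θ / 2π mod 1`. [folklore] -/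
theorem equivAddCircle_coe (θ : ℝ) :
    AddCircle.equivAddCircle (2 * Real.pi) 1 (by positivity) one_ne_zero (θ : Real.Angle) =
      ((θ / (2 * Real.pi) : ℝ) : UnitAddCircle) := by
  rw [show ((θ : Real.Angle) : AddCircle (2 * Real.pi)) = ((θ : ℝ) : AddCircle (2 * Real.pi)) from rfl,
    AddCircle.equivAddCircle_apply_mk, mul_one, div_eq_mul_inv]

/-- **`turn` is continuous off `0`.** [folklore] -/
theorem continuousAt_turn {z : ℂ} (hz : z ≠ 0) : ContinuousAt turn z :=
  (AddCircle.homeomorphAddCircle (2 * Real.pi) (1 : ℝ) (by positivity) one_ne_zero).continuous.continuousAt.comp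
    (Complex.continuousAt_arg_coe_angle hz)

/-- `turn` is continuous on `ℂ ∖ {0}`. [folklore] -/
theorem continuousOn_turn : ContinuousOn turn {0}ᶜ := fun _ hz ↦
  (continuousAt_turn hz).continuousWithinAt

/-- **`turn` is additive on products** of nonzero numbers (`arg (xy) ≡ arg x + arg y`).
[folklore] -/
theorem turn_mul {x y : ℂ} (hx : x ≠ 0) (hy : y ≠ 0) : turn (x * y) = turn x + turn y := by
  rw [turn_eq, Complex.arg_mul_coe_angle hx hy, map_add]
  rfl

/-- **`turn (exp ζ) = Im ζ / 2π (mod 1)`.** [folklore] -/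
theorem turn_exp (ζ : ℂ) : turn (Complex.exp ζ) = ((ζ.im / (2 * Real.pi) : ℝ) : UnitAddCircle) := by
  rw [turn_eq, Complex.arg_exp, Real.Angle.coe_toIocMod, equivAddCircle_coe]

end Turn

/-! ### Lifts and representatives: two elementary facts on `ℝ → ℝ/ℤ` -/

section Reps

/-- The representative in `[0,1)` of the class of a real number is its fractional part.
[cite: HatcherAT2002, Thm. 1.7] -/
theorem circleRep_coe (r : ℝ) : circleRep (r : UnitAddCircle) = Int.fract r := by
  have h : ((Int.fract r : ℝ) : UnitAddCircle) = (r : UnitAddCircle) := by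
    rw [Int.fract, sub_eq_add_neg, ← Int.cast_neg, coe_add_intCast]
  rw [← h, circleRep_coe_of_mem ⟨Int.fract_nonneg r, Int.fract_lt_one r⟩]

/-- The end point of the canonical lift of a path: integer part the winding value, fractional
part the representative of the end point. [cite: HatcherAT2002, Thm. 1.7] -/
theorem pathLift_one_eq {x y : UnitAddCircle} (γ : Path x y) :
    pathLift γ 1 = ⌊pathLift γ 1⌋ + circleRep y := by
  have h : circleRep y = Int.fract (pathLift γ 1) := by
    rw [← circleRep_coe, coe_pathLift, γ.target]
  rw [h, Int.floor_add_fract]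

end Reps

/-! ### Winding values of a nowhere-zero function along `1`-simplices -/

section Winding

variable {X : Type} [TopologicalSpace X] {A : Set X} {h : X → ℂ}

/-- The continuous inclusion of a subset. [folklore] -/
abbrev valMap' (A : Set X) : C(↥A, X) := ⟨Subtype.val, continuous_subtype_val⟩

/-- The image of the inclusion of a subset is the subset. [folklore] -/
theorem range_valMap' (A : Set X) : Set.range (valMap' A) = A := Subtype.range_coe

/-- **The angle map `x ↦ turn (h x)` on the subspace `A`**, continuous when `h` is continuous and
nowhere zero on `A`. [folklore] -/
def turnMap (hc : ContinuousOn h A) (h0 : ∀ x ∈ A, h x ≠ 0) : C(↥A, UnitAddCircle) where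
  toFun x := turn (h x)
  continuous_toFun := by
    have h1 : Continuous fun x : ↥A ↦ h x := hc.comp_continuous continuous_subtype_val fun x ↦ x.2
    exact continuous_iff_continuousAt.2 fun x ↦
      ContinuousAt.comp (f := fun x : ↥A ↦ h x) (g := turn) (continuousAt_turn (h0 x x.2)) h1.continuousAt

/-- Value of the angle map. [folklore] -/
@[simp]
theorem turnMap_apply (hc : ContinuousOn h A) (h0 : ∀ x ∈ A, h x ≠ 0) (x : ↥A) :
    turnMap hc h0 x = turn (h x) :=
  rfl

/-- A simplex with image in `A`, as a simplex of the subspace `↥A`. [folklore] -/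
def liftSub {n : ℕ} (τ : SingularSimplex X n) (hτ : τ.range ⊆ A) : SingularSimplex (↥A) n :=
  τ.liftEmb (j := valMap' A) Topology.IsEmbedding.subtypeVal (by rwa [range_valMap'])

/-- The lift composed with the inclusion is the simplex. [folklore] -/
theorem map_liftSub {n : ℕ} (τ : SingularSimplex X n) (hτ : τ.range ⊆ A) :
    (liftSub τ hτ).map (valMap' A) = τ :=
  map_liftEmb _ _ _

/-- The points of the lift are the points of the simplex. [folklore] -/
theorem coe_toContinuousMap_liftSub {n : ℕ} (τ : SingularSimplex X n) (hτ : τ.range ⊆ A)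
    (s : stdSimplex ℝ (Fin (n + 1))) :
    ((toContinuousMap (liftSub τ hτ) s : ↥A) : X) = toContinuousMap τ s := by
  conv_rhs => rw [← map_liftSub τ hτ]
  rfl

/-- Push-forward along an injective map is injective on simplices. [folklore] -/
theorem map_injective_of_injective {Y : Type} [TopologicalSpace Y] {f : C(X, Y)}
    (hf : Function.Injective f) {n : ℕ} : Function.Injective fun σ : SingularSimplex X n ↦ σ.map f := by
  intro σ σ' hσ
  apply toContinuousMap.injective
  ext s
  have h := congrArg (fun ρ : SingularSimplex Y n ↦ toContinuousMap ρ s) hσ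
  exact hf h

/-- Lifting commutes with faces. [folklore] -/
theorem liftSub_face {n : ℕ} (σ : SingularSimplex X (n + 1)) (hσ : σ.range ⊆ A) (i : Fin (n + 2)) :
    (liftSub σ hσ).face i = liftSub (σ.face i) ((σ.range_face_subset i).trans hσ) := by
  apply map_injective_of_injective (f := valMap' A) Subtype.val_injective
  change ((liftSub σ hσ).face i).map (valMap' A) = (liftSub (σ.face i) _).map (valMap' A)
  rw [← face_map, map_liftSub, map_liftSub]

variable (A h) in
open Classical in
/-- **The winding value of `h` along a `1`-simplex of `A`**: the integral winding cochain `ϑ` of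
`ℝ/ℤ` evaluated on `turn ∘ h ∘ τ` (and `0` on simplices leaving `A`). [cite: HatcherAT2002, §3.1 p. 198] -/
def windingValue (hc : ContinuousOn h A) (h0 : ∀ x ∈ A, h x ≠ 0) (τ : SingularSimplex X 1) : ℤ :=
  if hτ : τ.range ⊆ A then windingCochain ((liftSub τ hτ).map (turnMap hc h0)) else 0

/-- The winding value on a simplex of `A`. [folklore] -/
theorem windingValue_of_subset (hc : ContinuousOn h A) (h0 : ∀ x ∈ A, h x ≠ 0)
    {τ : SingularSimplex X 1} (hτ : τ.range ⊆ A) :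
    windingValue A h hc h0 τ = windingCochain ((liftSub τ hτ).map (turnMap hc h0)) := by
  rw [windingValue, dif_pos hτ]

/-- **The cocycle identity**: on a `2`-simplex of `A` the alternating sum of the winding values
of the faces vanishes (Hatcher Prop. 1.30: `ϑ` is a cocycle). [cite: HatcherAT2002, Prop. 1.30] -/
theorem windingValue_face (hc : ContinuousOn h A) (h0 : ∀ x ∈ A, h x ≠ 0)
    {σ : SingularSimplex X 2} (hσ : σ.range ⊆ A) :
    windingValue A h hc h0 (σ.face 0) - windingValue A h hc h0 (σ.face 1) +
      windingValue A h hc h0 (σ.face 2) = 0 := by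
  rw [windingValue_of_subset hc h0 ((σ.range_face_subset 0).trans hσ),
    windingValue_of_subset hc h0 ((σ.range_face_subset 1).trans hσ),
    windingValue_of_subset hc h0 ((σ.range_face_subset 2).trans hσ),
    ← liftSub_face σ hσ, ← liftSub_face σ hσ, ← liftSub_face σ hσ, ← face_map, ← face_map,
    ← face_map]
  exact windingCochain_boundary _

/-- **The angle path** `t ↦ turn (h (τ t))` of a `1`-simplex `τ` of `A`. [folklore] -/
def turnPath (hc : ContinuousOn h A) (h0 : ∀ x ∈ A, h x ≠ 0) (τ : SingularSimplex X 1)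
    (hτ : τ.range ⊆ A) : Path (turn (h (src τ))) (turn (h (tgt τ))) where
  toFun t := turn (h (τ.toPath t))
  continuous_toFun := by
    have h1 : Continuous fun t ↦ h (τ.toPath t) :=
      hc.comp_continuous τ.toPath.continuous fun t ↦ hτ ⟨_, rfl⟩
    exact continuous_iff_continuousAt.2 fun t ↦
      ContinuousAt.comp (f := fun t ↦ h (τ.toPath t)) (g := turn)
        (continuousAt_turn (h0 _ (hτ ⟨_, rfl⟩))) h1.continuousAt
  source' := rfl
  target' := rfl

/-- Values of the angle path. [folklore] -/
@[simp]
theorem turnPath_apply (hc : ContinuousOn h A) (h0 : ∀ x ∈ A, h x ≠ 0) (τ : SingularSimplex X 1)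
    (hτ : τ.range ⊆ A) (t : unitInterval) : turnPath hc h0 τ hτ t = turn (h (τ.toPath t)) :=
  rfl

/-- **The winding value as the end point of a lift**: `w(τ) = ⌊ℓ(1)⌋` for the lift `ℓ` of the
angle path of `τ` starting in `[0,1)` (Hatcher Thm. 1.7). [cite: HatcherAT2002, Thm. 1.7] -/
theorem windingValue_eq_floor (hc : ContinuousOn h A) (h0 : ∀ x ∈ A, h x ≠ 0)
    {τ : SingularSimplex X 1} (hτ : τ.range ⊆ A) :
    windingValue A h hc h0 τ = ⌊pathLift (turnPath hc h0 τ hτ) 1⌋ := by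
  rw [windingValue_of_subset hc h0 hτ, windingCochain_eq]
  congr 2
  refine pathLift_congr fun t ↦ ?_
  rw [turnPath_apply, toPath_apply, toPath_apply, toContinuousMap_map, ContinuousMap.comp_apply,
    turnMap_apply, coe_toContinuousMap_liftSub]

/-- **The coboundary identity.** If `h' = exp(G) · h` on `A' ⊆ A ∩ {h' continuous, non-zero}` with
`G` continuous on `A'`, then along every `1`-simplex `τ` of `A'`,
`w_{h'}(τ) = w_h(τ) + e(tgt τ) − e(src τ)` with `e = ⌊Im G / 2π + θ_h⌋`, `θ_h ∈ [0,1)` the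
normalised angle of `h` (unique path lifting, Hatcher Prop. 1.30). [cite: HatcherAT2002, Prop. 1.30] -/
theorem windingValue_mul_exp {A' : Set X} {h' G : X → ℂ} (hc : ContinuousOn h A)
    (h0 : ∀ x ∈ A, h x ≠ 0) (hc' : ContinuousOn h' A') (h0' : ∀ x ∈ A', h' x ≠ 0)
    (hA : A' ⊆ A) (hG : ContinuousOn G A') (hh' : ∀ x ∈ A', h' x = Complex.exp (G x) * h x)
    {τ : SingularSimplex X 1} (hτ : τ.range ⊆ A') :
    windingValue A' h' hc' h0' τ = windingValue A h hc h0 τ +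
      ⌊(G (tgt τ)).im / (2 * Real.pi) + circleRep (turn (h (tgt τ)))⌋ -
      ⌊(G (src τ)).im / (2 * Real.pi) + circleRep (turn (h (src τ)))⌋ := by
  have hτA : τ.range ⊆ A := hτ.trans hA
  set ρ : X → ℝ := fun x ↦ (G x).im / (2 * Real.pi) with hρ
  have hρc : Continuous fun t : unitInterval ↦ ρ (τ.toPath t) := by
    have h1 : Continuous fun t : unitInterval ↦ G (τ.toPath t) :=
      hG.comp_continuous τ.toPath.continuous fun t ↦ hτ ⟨_, rfl⟩
    exact (Complex.continuous_im.comp h1).div_const _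
  have hmem : ∀ t : unitInterval, τ.toPath t ∈ A' := fun t ↦ hτ ⟨_, rfl⟩
  -- the angle paths of `h` and `h'` differ by `ρ`
  have hturn : ∀ t, turnPath hc' h0' τ hτ t = ((ρ (τ.toPath t) : ℝ) : UnitAddCircle) + turnPath hc h0 τ hτA t := by
    intro t
    rw [turnPath_apply, turnPath_apply, hh' _ (hmem t),
      turn_mul (Complex.exp_ne_zero _) (h0 _ (hA (hmem t))), turn_exp]
  -- the shifted lift of the angle path of `h` lifts the angle path of `h'`
  set e₀ : ℤ := ⌊ρ (src τ) + circleRep (turn (h (src τ)))⌋ with he₀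
  set L : C(unitInterval, ℝ) :=
    ⟨fun t ↦ ρ (τ.toPath t) + pathLift (turnPath hc h0 τ hτA) t - e₀,
      (hρc.add (pathLift _).continuous).sub continuous_const⟩ with hL
  have hLift : L = pathLift (turnPath hc' h0' τ hτ) := by
    refine eq_pathLift L (fun t ↦ ?_) ?_
    · change (((ρ (τ.toPath t) + pathLift (turnPath hc h0 τ hτA) t - e₀ : ℝ)) : UnitAddCircle) = _
      rw [sub_eq_add_neg, ← Int.cast_neg, coe_add_intCast, AddCircle.coe_add, coe_pathLift, hturn]
    · change ρ (τ.toPath 0) + pathLift (turnPath hc h0 τ hτA) 0 - e₀ = circleRep (turn (h' (src τ)))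
      have hsrc : τ.toPath 0 = src τ := rfl
      have hR : circleRep (turn (h' (src τ))) = Int.fract (ρ (src τ) + circleRep (turn (h (src τ)))) := by
        rw [hh' _ (hτ ⟨_, rfl⟩), turn_mul (Complex.exp_ne_zero _) (h0 _ (hA (hτ ⟨_, rfl⟩))), turn_exp,
          ← circleRep_coe, AddCircle.coe_add, coe_circleRep]
      rw [pathLift_zero, hsrc, hR, he₀, Int.fract]
  rw [windingValue_eq_floor hc' h0' hτ, windingValue_eq_floor hc h0 hτA, ← hLift]
  change ⌊ρ (τ.toPath 1) + pathLift (turnPath hc h0 τ hτA) 1 - (e₀ : ℝ)⌋ = _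
  have htgt : τ.toPath 1 = tgt τ := rfl
  have hsplit := pathLift_one_eq (turnPath hc h0 τ hτA)
  set w : ℤ := ⌊pathLift (turnPath hc h0 τ hτA) 1⌋ with hw
  rw [Int.floor_sub_intCast, htgt, hsplit]
  have hre : ρ (tgt τ) + ((w : ℝ) + circleRep (turn (h (tgt τ)))) =
      (w : ℝ) + ((G (tgt τ)).im / (2 * Real.pi) + circleRep (turn (h (tgt τ)))) := by
    simp only [hρ]
    ring
  rw [hre, Int.floor_intCast_add]

end Winding

/-! ### The first Chern class of an exponential cocycle which is a coboundary of units -/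

section ChernVanishing

open Literature.Algebra.Homology

variable {R : Type*} [CommRing R] {X : Type} [TopologicalSpace X] {ι : Type*} (V : ι → Set X)
  {N : Type*} [AddCommGroup N] [Module R N] (φ : ℤ →+ N)

/-- The winding value does not depend on the set through which the simplex is read. [folklore] -/
theorem windingValue_congr_set {A B : Set X} {h : X → ℂ} (hcA : ContinuousOn h A)
    (h0A : ∀ x ∈ A, h x ≠ 0) (hcB : ContinuousOn h B) (h0B : ∀ x ∈ B, h x ≠ 0)
    {τ : SingularSimplex X 1} (hτA : τ.range ⊆ A) (hτB : τ.range ⊆ B) :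
    windingValue A h hcA h0A τ = windingValue B h hcB h0B τ := by
  rw [windingValue_eq_floor hcA h0A hτA, windingValue_eq_floor hcB h0B hτB]
  congr 2

/-- **The constant `0`-cochain** with value `m` (read in `N` through `φ : ℤ → N`) on `A`.
[folklore] -/
def intConstCochain (R : Type*) [CommRing R] {N : Type*} [AddCommGroup N] [Module R N] (φ : ℤ →+ N)
    (A : Set X) (m : ℤ) : CochainOn R N A 0 :=
  cochainOfFun A 0 fun _ ↦ φ m

/-- Values of the constant cochain. [folklore] -/
theorem evalSimplex_intConstCochain {A : Set X} (m : ℤ) {σ : SingularSimplex X 0} (hσ : σ.range ⊆ A) :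
    evalSimplex (intConstCochain R φ A m) σ = φ m :=
  evalSimplex_cochainOfFun _ hσ

/-- A constant `0`-cochain is a `0`-cocycle. [folklore] -/
theorem cod_intConstCochain (A : Set X) (m : ℤ) : cod A 0 (intConstCochain R φ A m) = 0 := by
  refine ext_evalSimplex fun σ hσ ↦ ?_
  rw [evalSimplex_cod _ hσ, Fin.sum_univ_two, evalSimplex_intConstCochain φ m ((σ.range_face_subset 0).trans hσ),
    evalSimplex_intConstCochain φ m ((σ.range_face_subset 1).trans hσ), evalSimplex_of_subset _ hσ,
    LinearMap.zero_apply]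
  simp

/-- Restriction of a constant cochain is the constant cochain. [folklore] -/
theorem cres_intConstCochain {A B : Set X} (hAB : A ⊆ B) (m : ℤ) :
    cres hAB 0 (intConstCochain R φ B m) = intConstCochain R φ A m := by
  refine ext_evalSimplex fun σ hσ ↦ ?_
  rw [evalSimplex_cres _ _ hσ, evalSimplex_intConstCochain φ m hσ, evalSimplex_intConstCochain φ m (hσ.trans hAB)]

/-- **The constant Čech `2`-cochain of `0`-cocycles** with values `n_{J₀ J₁ J₂}` (read in `N`).
[folklore] -/
def constCechCocycle (R : Type*) [CommRing R] {N : Type*} [AddCommGroup N] [Module R N] (φ : ℤ →+ N)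
    (n : ι → ι → ι → ℤ) : CechZeroCocycles R N V 2 := fun J ↦
  ⟨intConstCochain R φ (cechSet V J) (n (J 0) (J 1) (J 2)), LinearMap.mem_ker.2 (cod_intConstCochain φ _ _)⟩

/-- Underlying cochains of `constCechCocycle`. [folklore] -/
@[simp]
theorem coe_constCechCocycle (n : ι → ι → ι → ℤ) (J : Fin 3 → ι) :
    (constCechCocycle V R φ n J : CochainOn R N (cechSet V J) 0) =
      intConstCochain R φ (cechSet V J) (n (J 0) (J 1) (J 2)) :=
  rfl

/-- **A constant Čech `2`-cochain satisfying the cocycle identity on non-empty quadruple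
intersections is a Čech cocycle.** [cite: BottTu1982Forms, §8 (8.4)] -/
theorem constCechCocycle_mem_cocycles (n : ι → ι → ι → ℤ)
    (hn : ∀ i j k l, (V i ∩ V j ∩ V k ∩ V l).Nonempty → n j k l - n i k l + n i j l - n i j k = 0) :
    constCechCocycle V R φ n ∈ NatCochain.cocycles (cechZeroδ R N V) 2 := by
  rw [NatCochain.mem_cocycles_iff]
  funext J
  apply Subtype.ext
  rw [coe_cechZeroδ_apply]
  change _ = (0 : CochainOn R N (cechSet V J) 0)
  refine ext_evalSimplex fun σ hσ ↦ ?_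
  rw [evalSimplex_sum, Fin.sum_univ_four]
  simp only [evalSimplex_smul, coe_constCechCocycle]
  rw [evalSimplex_cres _ _ hσ, evalSimplex_cres _ _ hσ, evalSimplex_cres _ _ hσ, evalSimplex_cres _ _ hσ,
    evalSimplex_intConstCochain φ _ (hσ.trans (cechSet_subset_comp V J _)),
    evalSimplex_intConstCochain φ _ (hσ.trans (cechSet_subset_comp V J _)),
    evalSimplex_intConstCochain φ _ (hσ.trans (cechSet_subset_comp V J _)),
    evalSimplex_intConstCochain φ _ (hσ.trans (cechSet_subset_comp V J _)),
    evalSimplex_of_subset _ hσ, LinearMap.zero_apply]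
  have hne : (V (J 0) ∩ V (J 1) ∩ V (J 2) ∩ V (J 3)).Nonempty := by
    obtain ⟨x, hx⟩ := σ.range_nonempty
    have hx' := mem_cechSet_iff.1 (hσ hx)
    exact ⟨x, ⟨⟨hx' 0, hx' 1⟩, hx' 2⟩, hx' 3⟩
  have h := hn (J 0) (J 1) (J 2) (J 3) hne
  have e0 : ∀ m : Fin 3, (Fin.succAbove (0 : Fin 4) m) = m.succ := fun m ↦ rfl
  have h10 : (Fin.succAbove (1 : Fin 4) (0 : Fin 3)) = 0 := rfl
  have h11 : (Fin.succAbove (1 : Fin 4) (1 : Fin 3)) = 2 := rfl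
  have h12 : (Fin.succAbove (1 : Fin 4) (2 : Fin 3)) = 3 := rfl
  have h20 : (Fin.succAbove (2 : Fin 4) (0 : Fin 3)) = 0 := rfl
  have h21 : (Fin.succAbove (2 : Fin 4) (1 : Fin 3)) = 1 := rfl
  have h22 : (Fin.succAbove (2 : Fin 4) (2 : Fin 3)) = 3 := rfl
  have h30 : (Fin.succAbove (3 : Fin 4) (0 : Fin 3)) = 0 := rfl
  have h31 : (Fin.succAbove (3 : Fin 4) (1 : Fin 3)) = 1 := rfl
  have h32 : (Fin.succAbove (3 : Fin 4) (2 : Fin 3)) = 2 := rfl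
  simp only [Function.comp_apply, e0, h10, h11, h12, h20, h21, h22, h30, h31, h32, Fin.succ_zero_eq_one,
    Fin.succ_one_eq_two, show (2 : Fin 3).succ = (3 : Fin 4) from rfl, Fin.val_zero, pow_zero, one_smul,
    Fin.val_one, pow_one, neg_smul, Fin.val_two, neg_one_sq, show ((3 : Fin 4) : ℕ) = 3 from rfl,
    show ((-1 : R) ^ 3) = -1 by norm_num]
  have key : n (J 1) (J 2) (J 3) + -n (J 0) (J 2) (J 3) + n (J 0) (J 1) (J 3) + -n (J 0) (J 1) (J 2) = 0 := by
    linarith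
  rw [← map_neg, ← map_neg, ← map_add, ← map_add, ← map_add, key, map_zero]

/-- Transposition moves a single entry from `(0, n)` to `(n, 0)`. [folklore] -/
theorem swapₗ_single_zero {Y : ℕ → ℕ → Type*} [∀ p q, AddCommGroup (Y p q)]
    [∀ p q, Module R (Y p q)] (n : ℕ) (v : Y n 0) :
    ADoubleComplex.swapₗ R (ADoubleComplex.single (X := fun p q ↦ Y q p) 0 n v) =
      ADoubleComplex.single n 0 v := by
  funext p q
  rw [ADoubleComplex.swapₗ_apply]
  by_cases h : p = n ∧ q = 0
  · obtain ⟨rfl, rfl⟩ := h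
    rw [ADoubleComplex.single_apply_same, ADoubleComplex.single_apply_same]
  · rw [ADoubleComplex.single_apply_of_ne (by tauto), ADoubleComplex.single_apply_of_ne (by tauto)]

variable {V}

/-- **`c₁` of a coboundary of units vanishes.** Let `G_ij` be continuous on `V_i ∩ V_j` with
`G_ij + G_jk − G_ik = 2πi n_ijk` on `V_i ∩ V_j ∩ V_k` (`n_ijk ∈ ℤ`: so `exp G` is a cocycle and
`n` its integer Čech `2`-cocycle, Griffiths–Harris p. 141), and let `h_i` be continuous and nowhere
zero on `V_i` with `h_j = exp(G_ij) h_i` on `V_i ∩ V_j`. Then the image of `n` under the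
Čech-to-small map of the family `V` is zero. Proof: the winding `1`-cochains `w_i` of the `h_i` and
the `0`-cochains `e_ij = ⌊Im G_ij / 2π + θ_i⌋` form an element `y` of total degree `1` of the
Čech–singular double complex with `D y = η n` (`δ_sing w_i = 0`, `w_j − w_i = δ_sing e_ij`,
`e_jk − e_ik + e_ij = n_ijk`), so the collating criterion applies with the small cocycle `0`.
[cite: GriffithsHarris1978, pp. 139–141] [cite: HatcherAT2002, Prop. 1.30] -/
theorem cechToSmall_constCechCocycle_eq_zero_of_units
    (G : ι → ι → X → ℂ) (hG : ∀ i j, ContinuousOn (G i j) (V i ∩ V j))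
    (n : ι → ι → ι → ℤ)
    (hn : ∀ i j k, ∀ x ∈ V i ∩ V j ∩ V k, G i j x + G j k x - G i k x = 2 * Real.pi * Complex.I * n i j k)
    (h : ι → X → ℂ) (hc : ∀ i, ContinuousOn (h i) (V i)) (h0 : ∀ i, ∀ x ∈ V i, h i x ≠ 0)
    (hh : ∀ i j, ∀ x ∈ V i ∩ V j, h j x = Complex.exp (G i j x) * h i x)
    (hcoc : constCechCocycle V R φ n ∈ NatCochain.cocycles (cechZeroδ R N V) 2) :
    cechToSmall V 2 (NatCochain.Cohomology.mk _ 2 ⟨constCechCocycle V R φ n, hcoc⟩) = 0 := by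
  -- the imaginary parts of the `G_ij`, normalised, and the floors `e_ij`
  set ρ : ι → ι → X → ℝ := fun i j x ↦ (G i j x).im / (2 * Real.pi) with hρ
  set e : ι → ι → X → ℤ := fun i j x ↦ ⌊ρ i j x + circleRep (turn (h i x))⌋ with he
  have hρn : ∀ i j k, ∀ x ∈ V i ∩ V j ∩ V k, ρ i j x + ρ j k x - ρ i k x = n i j k := by
    intro i j k x hx
    have h1 := congrArg Complex.im (hn i j k x hx)
    simp only [Complex.sub_im, Complex.add_im, Complex.mul_im, Complex.mul_re, Complex.I_re, Complex.I_im,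
      Complex.ofReal_re, Complex.ofReal_im, Complex.intCast_re, Complex.intCast_im, Complex.re_ofNat,
      Complex.im_ofNat] at h1
    simp only [hρ]
    have hπ : (2 * Real.pi) ≠ 0 := by positivity
    field_simp
    linarith
  -- `θ_j = fract (ρ_ij + θ_i)`
  have hθ : ∀ i j, ∀ x ∈ V i ∩ V j,
      circleRep (turn (h j x)) = ρ i j x + circleRep (turn (h i x)) - e i j x := by
    intro i j x hx
    have h1 : turn (h j x) = ((ρ i j x + circleRep (turn (h i x)) : ℝ) : UnitAddCircle) := by
      rw [hh i j x hx, turn_mul (Complex.exp_ne_zero _) (h0 i x hx.1), turn_exp, AddCircle.coe_add,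
        coe_circleRep]
    rw [h1, circleRep_coe, he, Int.fract]
  have heq : ∀ i j k, ∀ x ∈ V i ∩ V j ∩ V k, e j k x - e i k x + e i j x = n i j k := by
    intro i j k x hx
    have h1 := hθ i j x ⟨hx.1.1, hx.1.2⟩
    have h2 := hθ j k x ⟨hx.1.2, hx.2⟩
    have h3 := hθ i k x ⟨hx.1.1, hx.2⟩
    have h4 := hρn i j k x hx
    have h5 : ((e j k x - e i k x + e i j x : ℤ) : ℝ) = n i j k := by
      push_cast
      linarith
    exact_mod_cast h5
  -- the element of total degree one
  set K := cechSingular R N V with hK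
  set y01 : CechCochain R N V 0 1 := fun J ↦
    cochainOfFun (cechSet V J) 1 (fun τ ↦ φ (windingValue (V (J 0)) (h (J 0)) (hc _) (h0 _) τ)) with hy01
  set y10 : CechCochain R N V 1 0 := fun J ↦
    cochainOfFun (cechSet V J) 0 (fun σ ↦ φ (e (J 0) (J 1) σ.pt)) with hy10
  -- (1) the winding cochains are cocycles
  have h1 : cechd R N V 0 1 y01 = 0 := by
    funext J
    rw [cechd_apply, pow_zero, one_smul]
    change cod (cechSet V J) 1 (y01 J) = 0
    refine ext_evalSimplex fun σ hσ ↦ ?_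
    have hσ0 : σ.range ⊆ V (J 0) := hσ.trans (cechSet_subset_apply V J 0)
    rw [evalSimplex_cod _ hσ, Fin.sum_univ_three, hy01,
      evalSimplex_cochainOfFun _ ((σ.range_face_subset 0).trans hσ),
      evalSimplex_cochainOfFun _ ((σ.range_face_subset 1).trans hσ),
      evalSimplex_cochainOfFun _ ((σ.range_face_subset 2).trans hσ),
      evalSimplex_of_subset _ hσ, LinearMap.zero_apply]
    simp only [Fin.val_zero, pow_zero, one_smul, Fin.val_one, pow_one, neg_smul, Fin.val_two, neg_one_sq]
    have hw := windingValue_face (hc (J 0)) (h0 (J 0)) hσ0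
    rw [← sub_eq_add_neg, ← map_sub, ← map_add, hw, map_zero]
  -- (2) `w_j − w_i = δ e_ij`
  have h2 : cechδ R N V 0 1 y01 + cechd R N V 1 0 y10 = 0 := by
    funext J
    rw [Pi.add_apply, Pi.zero_apply, cechd_apply, pow_one, neg_smul, one_smul]
    refine ext_evalSimplex fun τ hτ ↦ ?_
    have hτ0 : τ.range ⊆ V (J 0) := hτ.trans (cechSet_subset_apply V J 0)
    have hτ1 : τ.range ⊆ V (J 1) := hτ.trans (cechSet_subset_apply V J 1)
    have hτ01 : τ.range ⊆ V (J 0) ∩ V (J 1) := Set.subset_inter hτ0 hτ1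
    have hs0 : τ.range ⊆ cechSet V (J ∘ Fin.succAbove 0) := hτ.trans (cechSet_subset_comp V J _)
    have hs1 : τ.range ⊆ cechSet V (J ∘ Fin.succAbove 1) := hτ.trans (cechSet_subset_comp V J _)
    rw [evalSimplex_add, evalSimplex_cechδ V y01 hτ, Fin.sum_univ_two, evalSimplex_of_subset (0 : CochainOn R N _ 1) hτ,
      LinearMap.zero_apply]
    simp only [Fin.val_zero, pow_zero, one_smul, Fin.val_one, pow_one, neg_smul]
    rw [hy01, evalSimplex_cochainOfFun _ hs0, evalSimplex_cochainOfFun _ hs1]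
    have e00 : (J ∘ Fin.succAbove (0 : Fin 2)) 0 = J 1 := rfl
    have e10 : (J ∘ Fin.succAbove (1 : Fin 2)) 0 = J 0 := rfl
    simp only [e00, e10]
    -- the coboundary term
    have hcod : evalSimplex (-cod (cechSet V J) 0 (y10 J)) τ = -(φ (e (J 0) (J 1) (tgt τ)) - φ (e (J 0) (J 1) (src τ))) := by
      have hneg : -cod (cechSet V J) 0 (y10 J) = (-1 : R) • cod (cechSet V J) 0 (y10 J) := by
        rw [neg_one_smul]
      rw [hneg, evalSimplex_smul, neg_one_smul, evalSimplex_cod _ hτ, Fin.sum_univ_two, hy10,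
        evalSimplex_cochainOfFun _ ((τ.range_face_subset 0).trans hτ),
        evalSimplex_cochainOfFun _ ((τ.range_face_subset 1).trans hτ), face_zero_eq, face_one_eq,
        SingularSimplex.pt_ofPoint, SingularSimplex.pt_ofPoint]
      simp only [Fin.val_zero, pow_zero, one_smul, Fin.val_one, pow_one, neg_smul]
      abel
    rw [hcod]
    -- the winding values read through `V (J 1)` resp. `V (J 0) ∩ V (J 1)`
    have hcI : ContinuousOn (h (J 1)) (V (J 0) ∩ V (J 1)) := (hc (J 1)).mono Set.inter_subset_right
    have h0I : ∀ x ∈ V (J 0) ∩ V (J 1), h (J 1) x ≠ 0 := fun x hx ↦ h0 (J 1) x hx.2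
    rw [windingValue_congr_set (hc (J 1)) (h0 (J 1)) hcI h0I hτ1 hτ01,
      windingValue_mul_exp (hc (J 0)) (h0 (J 0)) hcI h0I Set.inter_subset_left (hG (J 0) (J 1))
        (hh (J 0) (J 1)) hτ01]
    simp only [he, hρ, map_add, map_sub]
    abel
  -- (3) `δ e = n`
  have h3 : cechδ R N V 1 0 y10 = cechZeroIncl R N V 2 (constCechCocycle V R φ n) := by
    funext J
    refine ext_evalSimplex fun σ hσ ↦ ?_
    change _ = evalSimplex (intConstCochain R φ (cechSet V J) (n (J 0) (J 1) (J 2))) σ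
    rw [evalSimplex_cechδ V y10 hσ, Fin.sum_univ_three, evalSimplex_intConstCochain φ _ hσ, hy10,
      evalSimplex_cochainOfFun _ (hσ.trans (cechSet_subset_comp V J _)),
      evalSimplex_cochainOfFun _ (hσ.trans (cechSet_subset_comp V J _)),
      evalSimplex_cochainOfFun _ (hσ.trans (cechSet_subset_comp V J _))]
    have e00 : (J ∘ Fin.succAbove (0 : Fin 3)) 0 = J 1 := rfl
    have e01 : (J ∘ Fin.succAbove (0 : Fin 3)) 1 = J 2 := rfl
    have e10 : (J ∘ Fin.succAbove (1 : Fin 3)) 0 = J 0 := rfl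
    have e11 : (J ∘ Fin.succAbove (1 : Fin 3)) 1 = J 2 := rfl
    have e20 : (J ∘ Fin.succAbove (2 : Fin 3)) 0 = J 0 := rfl
    have e21 : (J ∘ Fin.succAbove (2 : Fin 3)) 1 = J 1 := rfl
    simp only [e00, e01, e10, e11, e20, e21, Fin.val_zero, pow_zero, one_smul, Fin.val_one, pow_one,
      neg_smul, Fin.val_two, neg_one_sq]
    have hx : σ.pt ∈ V (J 0) ∩ V (J 1) ∩ V (J 2) := by
      have hx' := mem_cechSet_iff.1 (hσ σ.pt_mem_range)
      exact ⟨⟨hx' 0, hx' 1⟩, hx' 2⟩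
    have := heq (J 0) (J 1) (J 2) σ.pt hx
    rw [← this]
    simp only [map_add, map_sub]
    abel
  -- `D y = η n`
  set y : ∀ p q, CechCochain R N V p q :=
    ADoubleComplex.single 0 1 y01 + ADoubleComplex.single 1 0 y10 with hy
  have hyT : y ∈ ADoubleComplex.Tn R (X := CechCochain R N V) 1 :=
    Submodule.add_mem _ (ADoubleComplex.single_mem_Tn R 0 1 y01) (ADoubleComplex.single_mem_Tn R 1 0 y10)
  have hDy : K.totalD y = ADoubleComplex.single 2 0 (cechZeroIncl R N V 2 (constCechCocycle V R φ n)) := by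
    rw [hy, map_add, ADoubleComplex.totalD_single, ADoubleComplex.totalD_single]
    change ADoubleComplex.single 1 1 (cechδ R N V 0 1 y01) + ADoubleComplex.single 0 2 (cechd R N V 0 1 y01) +
      (ADoubleComplex.single 2 0 (cechδ R N V 1 0 y10) + ADoubleComplex.single 1 1 (cechd R N V 1 0 y10)) = _
    rw [h1, h3, ADoubleComplex.single_zero, add_zero, add_comm (ADoubleComplex.single 2 0 _), ← add_assoc,
      ← ADoubleComplex.single_add, h2, ADoubleComplex.single_zero, zero_add]
  -- the collating criterion with the small cocycle `0`
  have hzero : NatCochain.Cohomology.mk (cechSingularRow R N V).dA 2 (0 : ↥(NatCochain.cocycles _ 2)) = 0 :=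
    map_zero _
  rw [← hzero, cechToSmall_mk_eq_mk_iff]
  simp only [Submodule.coe_zero, map_zero, zero_sub, Submodule.neg_mem_iff]
  rw [ADoubleComplex.RowAugmentation.coe_εTot, swapₗ_single_zero]
  change ADoubleComplex.single 2 0 (cechZeroIncl R N V 2 (constCechCocycle V R φ n)) ∈ K.totB 2
  rw [ADoubleComplex.totB_succ, Submodule.mem_map]
  exact ⟨y, hyT, hDy⟩

end ChernVanishing

end Literature.AlgebraicTopology.SingularHomology

end
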